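import Literature.NumberTheory.LFunctions.WeilZeroSum
import Literature.Analysis.OperatorTheory.HalfLinePositiveDefinite
import Literature.Barriers.RiemannHypothesis.PseudoLaplacianSpacing
import HarnessLib

/-!
# RiemannHypothesis / RuelleBand — heat cone, transfer of the engine to `ζ`

Route `RiemannHypothesis/RuelleBand`, crux item stmt-RiemannHypothesis-2061 (`ExactFirstBand`),
line `Sketch` (heat cone), stub `stub_transfer` (helper file, `--supports`).

**Statement.** Pure bookkeeping. Assume the ENGINE of the line (taken here as a hypothesis): an
exponentially convex (bounded-positive-definite on the semigroup `((0,∞),+)`,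
`Literature.Analysis.OperatorTheory.IsBoundedHalfLinePD`) locally finite Dirichlet series
`t ↦ Re Σᵢ wᵢ e^{-t lᵢ}` over a countable index type (`wᵢ > 0`, `Re lᵢ > 0`, finite sublevel sets
`{Re lᵢ ≤ C}`, `Σ wᵢ e^{-t Re lᵢ} < ∞` for `t > 0`) has all its exponents `lᵢ` real. Assume the
heat trace `Z(t) = Σ_ρ m(ρ) e^{-t ρ(1-ρ)}` over the non-trivial zeros of `ζ` (tree index type
`Literature.NumberTheory.LFunctions.ZetaZeros.riemannZetaNontrivialZeros`, weight = multiplicity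
`riemannZetaZeroOrder`) is absolutely summable for `t > 0` and that `Re Z` is bounded-positive-definite.
Then every zero `s` of `ζ` with `0 < Re s < 1` has `Re s = 1/2` or `Im s = 0`.

**Proof.** Instantiate the engine with `ι :=` the non-trivial zeros (countable,
`WeilZeroSum.lean`), `w ρ := m(ρ)` (`≥ 1`, `riemannZetaNontrivialZeros.one_le_order`),
`l ρ := ρ(1-ρ)`: `Re(ρ(1-ρ)) = β - β² + γ² > 0` for `0 < β < 1`; `Re(ρ(1-ρ)) ≤ C` forces
`γ² ≤ max C 0` and `|β| < 1`, so the zero lies in a ball, and the zeros in a ball are finite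
(`riemannZetaNontrivialZeros_finite_inter_ball`); the casts `((m : ℝ) : ℂ) = (m : ℂ)` identify the
two heat traces. The engine gives `Im(s(1-s)) = 0`, i.e. `Re s = 1/2 ∨ Im s = 0`
(`Literature.Barriers.RiemannHypothesis.mul_one_sub_im_eq_zero_iff`, the Hilbert–Pólya mechanism).

Mathlib + `WeilZeroSum` + `HalfLinePositiveDefinite` + `PseudoLaplacianSpacing` (for the PROVED identity
`mul_one_sub_im_eq_zero_iff` only); no named fact is used; no definitions.
-/

set_option linter.dupNamespace false

noncomputable section

open Complex

namespace Summit.RiemannHypothesis.RiemannHypothesis.Theorems.RuelleBandExactFirstBand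

open Literature.NumberTheory.LFunctions
open Literature.Analysis.OperatorTheory

/-- `Re (s(1−s)) = Re s - (Re s)² + (Im s)²`. [folklore] -/
theorem stub_transfer_mul_one_sub_re (s : ℂ) :
    (s * (1 - s)).re = s.re - s.re ^ 2 + s.im ^ 2 := by
  simp only [Complex.mul_re, Complex.sub_re, Complex.one_re, Complex.sub_im, Complex.one_im]
  ring

/-- On the non-trivial zeros the Casimir parameter has positive real part:
`Re (ρ(1-ρ)) = β(1-β) + γ² > 0` for `0 < β < 1`. [folklore] -/
theorem stub_transfer_re_pos (ρ : ZetaZeros.riemannZetaNontrivialZeros) :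
    0 < ((ρ : ℂ) * (1 - (ρ : ℂ))).re := by
  rw [stub_transfer_mul_one_sub_re]
  have h0 := ZetaZeros.riemannZetaNontrivialZeros.re_pos ρ.2
  have h1 := ZetaZeros.riemannZetaNontrivialZeros.re_lt_one ρ.2
  nlinarith [sq_nonneg (ρ : ℂ).im]

/-- The weights `m(ρ)` are positive on the non-trivial zeros
(`riemannZetaNontrivialZeros.one_le_order`). [folklore] -/
theorem stub_transfer_weight_pos (ρ : ZetaZeros.riemannZetaNontrivialZeros) :
    0 < (riemannZetaZeroOrder (ρ : ℂ) : ℝ) := by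
  have h := ZetaZeros.riemannZetaNontrivialZeros.one_le_order ρ.2
  have h' : (0 : ℤ) < riemannZetaZeroOrder (ρ : ℂ) := by omega
  exact_mod_cast h'

/-- Local finiteness of the Casimir parameters: only finitely many non-trivial zeros have
`Re (ρ(1-ρ)) ≤ C` (such a zero has `γ² ≤ max C 0` and `|β| < 1`, hence lies in the ball of radius
`√(max C 0) + 2`, which contains finitely many zeros, `riemannZetaNontrivialZeros_finite_inter_ball`).
[folklore] -/
theorem stub_transfer_finite (C : ℝ) :
    {ρ : ZetaZeros.riemannZetaNontrivialZeros | ((ρ : ℂ) * (1 - (ρ : ℂ))).re ≤ C}.Finite := by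
  set R : ℝ := Real.sqrt (max C 0) + 2 with hR
  have hfin : (Subtype.val ⁻¹' (ZetaZeros.riemannZetaNontrivialZeros ∩ Metric.ball (0 : ℂ) R) :
      Set ZetaZeros.riemannZetaNontrivialZeros).Finite :=
    (riemannZetaNontrivialZeros_finite_inter_ball (0 : ℂ) R).preimage Subtype.val_injective.injOn
  refine hfin.subset ?_
  intro ρ hρ
  simp only [Set.mem_setOf_eq] at hρ
  simp only [Set.mem_preimage, Set.mem_inter_iff, Metric.mem_ball, dist_zero_right]
  refine ⟨ρ.2, ?_⟩
  have h0 := ZetaZeros.riemannZetaNontrivialZeros.re_pos ρ.2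
  have h1 := ZetaZeros.riemannZetaNontrivialZeros.re_lt_one ρ.2
  rw [stub_transfer_mul_one_sub_re] at hρ
  have hγ : (ρ : ℂ).im ^ 2 ≤ max C 0 := by
    have : (ρ : ℂ).im ^ 2 ≤ C := by nlinarith
    exact this.trans (le_max_left _ _)
  have hγ' : |(ρ : ℂ).im| ≤ Real.sqrt (max C 0) := by
    rw [← Real.sqrt_sq_eq_abs]
    exact Real.sqrt_le_sqrt hγ
  have hβ : |(ρ : ℂ).re| < 1 := by
    rw [abs_lt]
    constructor <;> linarith
  calc ‖(ρ : ℂ)‖ ≤ |(ρ : ℂ).re| + |(ρ : ℂ).im| := Complex.norm_le_abs_re_add_abs_im _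
    _ < 1 + Real.sqrt (max C 0) := by linarith
    _ < R := by rw [hR]; linarith

/-- **Stub `stub_transfer` (line `Sketch`, crux `ExactFirstBand`) — transfer of the engine to `ζ`.**
The engine (first hypothesis: an exponentially convex locally finite Dirichlet series has real
exponents), specialised to the non-trivial zeros with weights `m(ρ)` and exponents `ρ(1-ρ)`, together
with the absolute summability of the heat trace (second hypothesis) and its bounded positive
definiteness (third hypothesis), gives `Im (ρ(1-ρ)) = 0` at every non-trivial zero, i.e. every zero of
`ζ` in the open critical strip lies on the critical line or on the real axis. [folklore] -/
theorem stub_transfer :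
    (∀ (ι : Type) [Countable ι] (w : ι → ℝ) (l : ι → ℂ),
      (∀ i, 0 < w i) → (∀ i, 0 < (l i).re) → (∀ C : ℝ, {i | (l i).re ≤ C}.Finite) →
      (∀ t : ℝ, 0 < t → Summable (fun i => w i * Real.exp (-(t * (l i).re)))) →
      IsBoundedHalfLinePD (fun t : ℝ => (∑' i, ((w i : ℝ) : ℂ) * cexp (-((t : ℂ) * l i))).re) →
      ∀ i, (l i).im = 0) →
    (∀ t : ℝ, 0 < t → Summable (fun ρ : ZetaZeros.riemannZetaNontrivialZeros =>
      (riemannZetaZeroOrder (ρ : ℂ) : ℝ) * Real.exp (-(t * ((ρ : ℂ) * (1 - (ρ : ℂ))).re)))) →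
    IsBoundedHalfLinePD (fun t : ℝ => (∑' ρ : ZetaZeros.riemannZetaNontrivialZeros,
      (riemannZetaZeroOrder (ρ : ℂ) : ℂ) * cexp (-((t : ℂ) * ((ρ : ℂ) * (1 - (ρ : ℂ)))))).re) →
    ∀ s : ℂ, riemannZeta s = 0 → 0 < s.re → s.re < 1 → s.re = 1 / 2 ∨ s.im = 0 := by
  intro hEngine hSum hPD s hs h0 h1
  have hmem : s ∈ ZetaZeros.riemannZetaNontrivialZeros :=
    ZetaZeros.riemannZetaNontrivialZeros.mem_iff'.2 ⟨hs, h0, h1⟩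
  have hPD' : IsBoundedHalfLinePD (fun t : ℝ => (∑' ρ : ZetaZeros.riemannZetaNontrivialZeros,
      (((riemannZetaZeroOrder (ρ : ℂ) : ℝ) : ℝ) : ℂ) *
        cexp (-((t : ℂ) * ((ρ : ℂ) * (1 - (ρ : ℂ)))))).re) := by
    simp only [Complex.ofReal_intCast]
    exact hPD
  have key : ((s : ℂ) * (1 - s)).im = 0 :=
    hEngine (↥ZetaZeros.riemannZetaNontrivialZeros)
      (fun ρ => (riemannZetaZeroOrder (ρ : ℂ) : ℝ)) (fun ρ => (ρ : ℂ) * (1 - (ρ : ℂ)))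
      stub_transfer_weight_pos stub_transfer_re_pos stub_transfer_finite hSum hPD' ⟨s, hmem⟩
  exact (Literature.Barriers.RiemannHypothesis.mul_one_sub_im_eq_zero_iff s).1 key

end Summit.RiemannHypothesis.RiemannHypothesis.Theorems.RuelleBandExactFirstBand

end
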